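import Summits.AtomisticToContinuum.BoseEinsteinCondensation.Theorems.BECInsertionCorrectorCorrectorClosureOccupationFloorFK
import Summits.AtomisticToContinuum.BoseEinsteinCondensation.Theorems.BECInsertionCorrectorResidueCondenses
import HarnessLib

/-!
# The heart of line `residue-area-law` factorises EXACTLY: residue = torus BEC × removal fidelity
# (crux `BECInsertionCorrector.CorrectorClosure`, item stmt-AtomisticToContinuum-12058, skeleton v6)

Crux `CorrectorClosure := StaticResponseBound → InsertionResidue`, line `residue-area-law`.

Skeleton v6 of the line replaced the v5 heart — an `N`-uniform floor `c ≤ A` on the insertion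
residue `A = L⁻³ (∫_{cell^N} Θ₀ G)²` of the torus Feynman–Kac ground states `Θ₀` (`N` bodies),
`Φ₀` (`N+1` bodies), `G(X) = ∫_cell Φ₀(x, X) dx` the zero-mode removal amplitude — by the two factors
of `A = f₀ · F`: the one-particle zero-mode occupation `f₀ = taggedZeroModeOccupation N L Φ₀`
(`= L⁻³ ∫ G²`, torus BEC of the true ground state) and the removal fidelity `F = (∫Θ₀G)²/∫G²`. The
glue of the skeleton proves `f₀ ≥ c₁ ∧ F ≥ c₂ ⟹ A ≥ c₁c₂`. This file proves the CONVERSE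
inequalities at fixed `N, L`, so that the reshape is an equivalence and loses nothing:

* `residue_le_taggedZeroModeOccupation` — `A ≤ f₀` for cell-normalised measurable `Θ₀` (Cauchy–
  Schwarz in `X`; the FK-ground-state form of Disproof §5 /
  `Negative.overlap_sq_le_taggedZeroModeOccupation`, which is stated for `C¹` trial states):
  an `A`-floor forces torus BEC of `Φ₀`;
* `taggedZeroModeOccupation_ofReal_le_one` — `f₀ ≤ 1` for a cell-normalised `Φ₀`;
* `residue_mul_le_removalOverlap_sq` — `A · ∫G² ≤ (∫Θ₀G)²`, i.e. `F ≥ A`: an `A`-floor `c` is an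
  `F`-floor `c` (in the division-free currency of `stub_removalFidelity`).
* `periodicBEC_of_correctorClosure` — at the level of the ROUTE DECLS: `CorrectorClosure` and
  `StaticResponseBound` give the summit-wide torus-BEC statement (the body of `PeriodicBEC`, item
  stmt-AtomisticToContinuum-0826) for EVERY admissible `v`, through the proved support
  `ResidueCondenses`; so `StaticResponseBound → PeriodicBEC` is NECESSARY for the crux — the content of
  the registered open stub `stub_periodicBEC` is not an artefact of the line.
-/

noncomputable section

open MeasureTheory Filter Matrix
open scoped ENNReal NNReal BigOperators ComplexConjugate

namespace Summit.AtomisticToContinuum.BoseEinsteinCondensation.Theorems.CorrectorClosure.ResidueAreaLaw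

open Literature.MathematicalPhysics.QuantumManyBody.BoseGas
open Summit.AtomisticToContinuum.BoseEinsteinCondensation.Theses.BECInsertionCorrector
open Summit.AtomisticToContinuum.BoseEinsteinCondensation.Theorems.CorrectorClosure.HealingScaleKacInsertion
  (overlap_ofReal lintegral_nnnorm_ofReal_sq_eq_one)

variable {N : ℕ} {L : ℝ}

/-- The removal amplitude `G(X) = ∫_cell Φ₀(x, X) dx` of a positive function is nonnegative.
[folklore] -/
theorem removalAmplitude_nonneg' (L : ℝ) {Φ₀ : Config (N + 1) → ℝ} (hΦp : ∀ X, 0 < Φ₀ X)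
    (X : Config N) : 0 ≤ ∫ x in cell L, Φ₀ (vecCons x X) :=
  setIntegral_nonneg (measurableSet_cell L) fun _ _ => (hΦp _).le

/-- Pointwise: `‖∫_cell (Φ₀ : ℂ)(vecCons x X) dx‖₊² = ofReal (∫_cell Φ₀(vecCons x X) dx)²` for a
positive `Φ₀`. [folklore] -/
theorem nnnorm_setIntegral_ofReal_sq (L : ℝ) {Φ₀ : Config (N + 1) → ℝ} (hΦp : ∀ X, 0 < Φ₀ X)
    (X : Config N) :
    ((‖∫ x in cell L, ((Φ₀ (vecCons x X) : ℝ) : ℂ)‖₊ : ℝ≥0∞)) ^ 2 =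
      ENNReal.ofReal (∫ x in cell L, Φ₀ (vecCons x X)) ^ 2 := by
  have hG : 0 ≤ ∫ x in cell L, Φ₀ (vecCons x X) := removalAmplitude_nonneg' L hΦp X
  have h1 : (∫ x in cell L, ((Φ₀ (vecCons x X) : ℝ) : ℂ)) =
      ((∫ x in cell L, Φ₀ (vecCons x X) : ℝ) : ℂ) := integral_ofReal
  rw [h1, ← enorm_eq_nnnorm, ← ofReal_norm, Complex.norm_real, Real.norm_of_nonneg hG]

/-- **The zero-mode occupation of a real positive function in removal-amplitude form**:
`taggedZeroModeOccupation N L Φ₀ = (ofReal L ^ 3)⁻¹ ∫⁻_{cell^N} ofReal (G X)²`,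
`G X = ∫_cell Φ₀(x, X) dx`. [folklore] -/
theorem taggedZeroModeOccupation_ofReal_eq (L : ℝ) {Φ₀ : Config (N + 1) → ℝ}
    (hΦp : ∀ X, 0 < Φ₀ X) :
    taggedZeroModeOccupation N L (fun X => (Φ₀ X : ℂ)) =
      (ENNReal.ofReal L ^ 3)⁻¹ *
        ∫⁻ X in cellN N L, ENNReal.ofReal (∫ x in cell L, Φ₀ (vecCons x X)) ^ 2 := by
  rw [taggedZeroModeOccupation_def]
  congr 1
  exact lintegral_congr fun X => nnnorm_setIntegral_ofReal_sq L hΦp X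

/-- **`A ≤ f₀` for Feynman–Kac data**: for a cell-normalised measurable `Θ₀ : Config N → ℝ`
(`∫⁻_{cell^N} ofReal Θ₀² = 1`, here an FK ground state) and a measurable real `Φ₀`, the
insertion residue is at most the one-particle zero-mode occupation of `Φ₀`:
`ofReal (L⁻³ (∫ Θ₀ G)²) ≤ taggedZeroModeOccupation N L Φ₀` (Cauchy–Schwarz in `X`). Hence any
`N`-uniform floor on `A` is torus BEC of the true `(N+1)`-body ground state. [folklore] -/
theorem residue_le_taggedZeroModeOccupation (hL : 0 < L) {v : ℝ → ℝ≥0∞} {Θ₀ : Config N → ℝ}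
    (hΘ : IsPeriodicGroundStateFK v L Θ₀) {Φ₀ : Config (N + 1) → ℝ} (hΦm : Measurable Φ₀) :
    ENNReal.ofReal ((L ^ 3)⁻¹ *
        (∫ X in cellN N L, Θ₀ X * ∫ x in cell L, Φ₀ (vecCons x X)) ^ 2) ≤
      taggedZeroModeOccupation N L (fun X => (Φ₀ X : ℂ)) := by
  -- complex forms
  set F : Config N → ℂ := fun X => (Θ₀ X : ℂ) with hF_def
  set Gc : Config (N + 1) → ℂ := fun Z => (Φ₀ Z : ℂ) with hGc_def
  set g : Config N → ℂ := fun X => ∫ x in cell L, Gc (vecCons x X) with hg_def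
  have hFm : Measurable F := Complex.measurable_ofReal.comp hΘ.measurable
  have hGcm : Measurable Gc := Complex.measurable_ofReal.comp hΦm
  have hgm : Measurable g := measurable_setIntegral_vecCons hGcm _
  -- Cauchy–Schwarz in `X`
  have hCS := sq_nnnorm_integral_mul_conj_le (ν := volume.restrict (cellN N L)) (f := g)
    (g := F) hgm.aemeasurable hFm.aemeasurable
  rw [lintegral_nnnorm_ofReal_sq_eq_one hΘ, mul_one] at hCS
  -- identify the real overlap with the complex one
  have hov : (∫ X in cellN N L, g X * conj (F X)) =
      ((∫ X in cellN N L, Θ₀ X * ∫ x in cell L, Φ₀ (vecCons x X) : ℝ) : ℂ) := by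
    rw [← overlap_ofReal L Θ₀ Φ₀]
    congr 1; funext X; ring
  have hsq : ENNReal.ofReal ((∫ X in cellN N L, Θ₀ X * ∫ x in cell L, Φ₀ (vecCons x X)) ^ 2) =
      (‖∫ X in cellN N L, g X * conj (F X)‖₊ : ℝ≥0∞) ^ 2 := by
    rw [hov, ← enorm_eq_nnnorm, ← ofReal_norm, Complex.norm_real, Real.norm_eq_abs,
      ← ENNReal.ofReal_pow (abs_nonneg _), sq_abs]
  have hL3 : (L ^ 3)⁻¹ = ((L ^ 3)⁻¹ : ℝ) := rfl
  rw [ENNReal.ofReal_mul (by positivity), hsq, ENNReal.ofReal_inv_of_pos (by positivity),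
    ENNReal.ofReal_pow hL.le, taggedZeroModeOccupation_def]
  gcongr

/-- **`f₀ ≤ 1` for a cell-normalised state**: the one-particle zero-mode occupation of (the
complexification of) an FK ground state is at most `1` (Cauchy–Schwarz in the removed coordinate,
`taggedZeroModeOccupation_le_lintegral`, p120721, and the normalisation). [folklore] -/
theorem taggedZeroModeOccupation_ofReal_le_one (hL : 0 < L) {v : ℝ → ℝ≥0∞}
    {Φ₀ : Config (N + 1) → ℝ} (hΦ : IsPeriodicGroundStateFK v L Φ₀) :
    taggedZeroModeOccupation N L (fun X => (Φ₀ X : ℂ)) ≤ 1 := by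
  have hm : Measurable fun X => (Φ₀ X : ℂ) := Complex.measurable_ofReal.comp hΦ.measurable
  refine (taggedZeroModeOccupation_le_lintegral hL hm).trans_eq ?_
  exact lintegral_nnnorm_ofReal_sq_eq_one hΦ

/-- **`F ≥ A` in division-free form**: `A · ∫⁻ ofReal G² ≤ ofReal (∫ Θ₀ G)²`, i.e. an `A`-floor
`c ≤ A` gives the removal-fidelity floor `c ∫G² ≤ (∫Θ₀G)²` of `stub_removalFidelity` with the same
constant (because `L⁻³ ∫ G² = f₀ ≤ 1`). [folklore] -/
theorem residue_mul_le_removalOverlap_sq (hL : 0 < L) {v : ℝ → ℝ≥0∞} {Θ₀ : Config N → ℝ}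
    {Φ₀ : Config (N + 1) → ℝ} (hΦ : IsPeriodicGroundStateFK v L Φ₀) (hΦp : ∀ X, 0 < Φ₀ X) :
    ENNReal.ofReal ((L ^ 3)⁻¹ *
        (∫ X in cellN N L, Θ₀ X * ∫ x in cell L, Φ₀ (vecCons x X)) ^ 2) *
        ∫⁻ X in cellN N L, ENNReal.ofReal (∫ x in cell L, Φ₀ (vecCons x X)) ^ 2 ≤
      ENNReal.ofReal ((∫ X in cellN N L, Θ₀ X * ∫ x in cell L, Φ₀ (vecCons x X)) ^ 2) := by
  have hf₀ := taggedZeroModeOccupation_ofReal_le_one (N := N) hL hΦ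
  rw [taggedZeroModeOccupation_ofReal_eq L hΦp] at hf₀
  have hL3 : ENNReal.ofReal L ^ 3 ≠ 0 := pow_ne_zero _ (ENNReal.ofReal_pos.2 hL).ne'
  have hL3' : ENNReal.ofReal L ^ 3 ≠ ⊤ := ENNReal.pow_ne_top ENNReal.ofReal_ne_top
  set I : ℝ := ∫ X in cellN N L, Θ₀ X * ∫ x in cell L, Φ₀ (vecCons x X) with hI
  set J : ℝ≥0∞ := ∫⁻ X in cellN N L, ENNReal.ofReal (∫ x in cell L, Φ₀ (vecCons x X)) ^ 2 with hJ
  calc ENNReal.ofReal ((L ^ 3)⁻¹ * I ^ 2) * J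
      = ENNReal.ofReal (I ^ 2) * ((ENNReal.ofReal L ^ 3)⁻¹ * J) := by
        rw [ENNReal.ofReal_mul (by positivity), ENNReal.ofReal_inv_of_pos (by positivity),
          ENNReal.ofReal_pow hL.le]; ring
    _ ≤ ENNReal.ofReal (I ^ 2) * 1 := by gcongr
    _ = ENNReal.ofReal (I ^ 2) := mul_one _

/-- **The crux contains torus BEC given K1, for every admissible potential.** From
`CorrectorClosure` and `StaticResponseBound` the target `InsertionResidue` follows by modus ponens,
and the PROVED support `ResidueCondenses` (item stmt-AtomisticToContinuum-12059) turns it into the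
summit-wide torus-BEC statement — the body of `PeriodicBEC` (item stmt-AtomisticToContinuum-0826),
verbatim the hypothesis `BoundaryTransferWeak` consumes — for EVERY repulsive finite-range `v`
(hard cores included). So the registered open stub `stub_periodicBEC` (`StaticResponseBound →`
this body, bounded `v`) is NECESSARY for the crux, not an artefact of the line. [folklore] -/
theorem periodicBEC_of_correctorClosure (hCC : CorrectorClosure) (hK1 : StaticResponseBound) :
    ∀ v : ℝ → ℝ≥0∞, IsRepulsiveFiniteRange v → ∃ ρ₀ : ℝ, 0 < ρ₀ ∧ ∀ ρ : ℝ, 0 < ρ → ρ < ρ₀ →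
      ∃ c : ℝ, 0 < c ∧ ∀ᶠ N : ℕ in Filter.atTop, ∃ δ : ℝ≥0∞, 0 < δ ∧
        ∀ Ψ : PeriodicTrialState N (sideLength ρ N),
          periodicEnergy v Ψ ≤ periodicGroundStateEnergy v N (sideLength ρ N) + δ →
          ENNReal.ofReal (c * N) ≤ condensateOccupation N (sideLength ρ N) Ψ.ψ :=
  Summit.AtomisticToContinuum.BoseEinsteinCondensation.Theorems.ResidueCondenses_proof (hCC hK1)

end Summit.AtomisticToContinuum.BoseEinsteinCondensation.Theorems.CorrectorClosure.ResidueAreaLaw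

end
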